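import Summits.HodgeConjecture.HodgeConjecture.Theorems.VHCAbelianSchemesRoadRegimeLocal
import Summits.HodgeConjecture.HodgeConjecture.Theorems.VHCAbelianSchemesRoadDesignNecessary
import HarnessLib

/-!
# Road b02 (`VHCAbelianSchemesRoad`, D-0059) — HYGIENE of the local-in-the-fibre crux (director-hodge R11.4 (h1)/(h2)):
# the ISOTRIVIAL instance (pointwise data on `X_t` serve the fibre `t`) and the EMPTY family (`k = 0` = the Lefschetz case)

research route conditional on HC_CM; not a corollary; Q11.4-sentence-2 already refuted in dim ≥ 3.
(cell line of seat ab-andre-2: research route, not a corollary; conditional on HC_CM plus one named minimal statement.)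

THEOREMS ONLY (no definition, no named fact, no sorry; `HC_CM` occurs nowhere). Seat ab-andre-2 gen 66; helper
`--supports stmt-HodgeConjecture-20707`; the route, its `closes` glue, the binders of record and the skeleton are NOT touched. The two
points where the tribunal's round 4 will probe the local predicate `AdmissibleRepresentativesLefAtDegLocal` /
`LefAtExceptionalRegimeAtLocal` (`VHCAbelianSchemesRoadRegimeLocal.lean`), made kernel facts:

* §1 (h2) THE EMPTY FAMILY IS THE LEFSCHETZ CASE, NOT A LEAK: additive data with `k = 0` force `a•W + Z = 0`, so the carried class is
  fibrewise algebraic-Lefschetz on the serving pencil (`addData_zero_mem`), and at the served fibre `t` the class `W|_{X_t}` is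
  algebraic AND Lefschetz (`local_datum_zero_mem`: transport along the fibre isomorphism `e`, `mem_algebraicClasses_map_iff_of_iso` and
  `map_mem_divisorClassesSpan`). The `∃` of the local predicate cannot be met by junk: it asks for a complex point `t'` of `S'` and an
  isomorphism `e : X'_{t'} ≅ X_t` of `ℂ`-schemes, and downstream uses `e` only to move algebraicity.
* §2 (h1) THE ISOTRIVIAL INSTANCE: for an object class that RESPECTS ISOMORPHISMS (hypothesis `h𝒪`, as the twisted doors do), POINTWISE
  span-representability on the fibre `X_t` — finitely many `𝒪`-data `(I i, κ i)` ON `X_t` with `κ i q` of type `(q,q)` and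
  `a•W|_{X_t} + z = ∑ i, c i • κ i p`, `z` algebraic-Lefschetz on `X_t` — serves the fibre `t` in the local predicate through the
  CONSTANT pencil `pr₂ : X_t × 𝔸¹ ⟶ 𝔸¹` (`local_conclusion_of_pointwise`; the constant-pencil binders of
  `VHCAbelianSchemesRoadDesignNecessary.lean` §1–§2: every class extends as `pr₁^*`, restriction to a fibre is pull-back along the slice
  isomorphism). So the honest residual per fibre of a Weil-cell pencil reads: EITHER a transport family through `X_t` on which the
  carried classes are global (the mechanism) OR pointwise admissible representatives on `X_t` itself (the Hodge question at `X_t` with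
  admissible objects) — the local predicate makes neither free.

References: [Hartshorne1977] II.3, II Ex. 4.9; [vanGeemen1994HodgeAV] §2.4; [Bloch1972Semiregularity] Rem. (7.5); [GrothendieckTopology1969] §1;
[BuchweitzFlenner2003] §5 Thm. 5.1.
-/

noncomputable section

open CategoryTheory CategoryTheory.Limits AlgebraicGeometry Topology MonoidalCategory CartesianMonoidalCategory

namespace Summit.HodgeConjecture.HodgeConjecture.Ring2.SemiregularRepresentatives

set_option linter.dupNamespace false -- the cell's namespace repeats the summit name, as in every `Ring2*` file

open Literature.AlgebraicGeometry Literature.AlgebraicGeometry.Motives Literature.AlgebraicGeometry.HodgeTheory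
open Literature.AlgebraicTopology.SingularHomology
open Literature.Barriers.HodgeConjecture (divisorClassesSpan)
open Summit.Ventures.HSemireg (ObjClass)

variable {𝒪 : ObjClass} {n p : ℕ} {𝒳 S : SchemeOver ℂ}

/-! ## §1 (h2) The empty family is the Lefschetz case -/

/-- **Additive data with `k = 0` force the carried class to be fibrewise algebraic-Lefschetz** on the serving pencil:
`a•W + Z = ∑ i : Fin 0, … = 0`, so `W = −a⁻¹Z`. [cite: vanGeemen1994HodgeAV, §2.4] -/
theorem addData_zero_mem (f : 𝒳 ⟶ S) (W : complexBetti 𝒳 (2 * p)) {V : Fin 0 → (q : ℕ) → complexBetti 𝒳 (2 * q)}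
    {c : Fin 0 → ℂ} {a : ℂ} {Z : complexBetti 𝒳 (2 * p)} (ha : a ≠ 0)
    (hZ : ∀ u : ComplexPoints S,
      complexBetti.map (fiberι f u) (2 * p) Z ∈ algebraicClasses (fiberOver f u) p ∧
      complexBetti.map (fiberι f u) (2 * p) Z ∈ divisorClassesSpan (fiberOver f u) n p)
    (hsum : a • W + Z = ∑ i, c i • V i p) (u : ComplexPoints S) :
    complexBetti.map (fiberι f u) (2 * p) W ∈ algebraicClasses (fiberOver f u) p ∧
      complexBetti.map (fiberι f u) (2 * p) W ∈ divisorClassesSpan (fiberOver f u) n p := by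
  have h0 : a • W + Z = 0 := by rw [hsum, Fin.sum_univ_zero]
  have h1 : a • W = -Z := (neg_eq_of_add_eq_zero_left h0).symm
  have hW : W = -(a⁻¹ • Z) := by
    calc W = a⁻¹ • (a • W) := by rw [smul_smul, inv_mul_cancel₀ ha, one_smul]
      _ = -(a⁻¹ • Z) := by rw [h1, smul_neg]
  rw [hW, map_neg, map_smul]
  exact ⟨Submodule.neg_mem _ (Submodule.smul_mem _ _ (hZ u).1), Submodule.neg_mem _ (Submodule.smul_mem _ _ (hZ u).2)⟩

/-- **A local datum with the EMPTY family at the fibre `t` says: `W|_{X_t}` is algebraic AND Lefschetz** (the on-path Lefschetz case,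
served datum-free; transport along the fibre isomorphism `e : X'_{t'} ≅ X_t`). [cite: vanGeemen1994HodgeAV, §2.4]
[cite: GrothendieckTopology1969, §1] -/
theorem local_datum_zero_mem (f : 𝒳 ⟶ S) (hf : IsSmoothProjectiveFamily f n) (W : complexBetti 𝒳 (2 * p)) (t : ComplexPoints S)
    {𝒳' S' : SchemeOver ℂ} (f' : 𝒳' ⟶ S') (hf' : IsSmoothProjectiveFamily f' n) {t' : ComplexPoints S'}
    (e : fiberOver f' t' ≅ fiberOver f t) {W' : complexBetti 𝒳' (2 * p)}
    (hWe : complexBetti.map e.hom (2 * p) (complexBetti.map (fiberι f t) (2 * p) W) =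
      complexBetti.map (fiberι f' t') (2 * p) W')
    {V : Fin 0 → (q : ℕ) → complexBetti 𝒳' (2 * q)} {c : Fin 0 → ℂ} {a : ℂ} {Z : complexBetti 𝒳' (2 * p)} (ha : a ≠ 0)
    (hZ : ∀ u : ComplexPoints S',
      complexBetti.map (fiberι f' u) (2 * p) Z ∈ algebraicClasses (fiberOver f' u) p ∧
      complexBetti.map (fiberι f' u) (2 * p) Z ∈ divisorClassesSpan (fiberOver f' u) n p)
    (hsum : a • W' + Z = ∑ i, c i • V i p) :
    complexBetti.map (fiberι f t) (2 * p) W ∈ algebraicClasses (fiberOver f t) p ∧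
      complexBetti.map (fiberι f t) (2 * p) W ∈ divisorClassesSpan (fiberOver f t) n p := by
  obtain ⟨halg, hlef⟩ := addData_zero_mem f' W' ha hZ hsum t'
  rw [← hWe] at halg hlef
  refine ⟨(mem_algebraicClasses_map_iff_of_iso e).1 halg, ?_⟩
  have h := map_mem_divisorClassesSpan (hf.isSmoothProjective t) (hf'.isSmoothProjective t') e.inv hlef
  rwa [e.complexBetti_map_inv_map_hom] at h

/-! ## §2 (h1) The isotrivial instance: pointwise data on `X_t` serve the fibre `t` -/

/-- **Pointwise span-representability on a fibre serves that fibre in the local predicate** (constant pencil `X_t × 𝔸¹ ⟶ 𝔸¹`): for an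
object class `𝒪` that respects isomorphisms of `ℂ`-schemes (`h𝒪`), finitely many `𝒪`-data `(I i, κ i)` ON `X_t := 𝒳_t`, each `κ i q`
of type `(q,q)`, `p ∈ I i`, a scalar `a ≠ 0` and an algebraic Lefschetz class `z` on `X_t` with `a•W|_{X_t} + z = ∑ i, c i • κ i p` give the
conclusion of `AdmissibleRepresentativesLefAtDegLocal` / `LefAtExceptionalRegimeAtLocal` at `t`: the serving pencil is `pr₂ : X_t × 𝔸¹ ⟶ 𝔸¹`
(smooth projective family of relative dimension `n`, quasi-projective, over the smooth irreducible affine line), the fibre isomorphism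
is the slice `X_t ≅ (X_t × 𝔸¹)_{s₀}`, all classes extend as `pr₁^*`, the data sit on the slice. [cite: Hartshorne1977, II.3 (p. 89) and II Ex. 4.9]
[cite: Bloch1972Semiregularity, Remark (7.5)] [cite: vanGeemen1994HodgeAV, §2.4] -/
theorem local_conclusion_of_pointwise
    (h𝒪 : ∀ (n : ℕ) ⦃Y Y' : SchemeOver ℂ⦄ (e : Y' ≅ Y) (I : Finset ℕ) (κ : (q : ℕ) → complexBetti Y (2 * q)),
      𝒪 n Y I κ → 𝒪 n Y' I (fun q ↦ complexBetti.map e.hom (2 * q) (κ q)))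
    (f : 𝒳 ⟶ S) (hf : IsSmoothProjectiveFamily f n) (W : complexBetti 𝒳 (2 * p)) (t : ComplexPoints S)
    {k : ℕ} {I : Fin k → Finset ℕ} {κ : Fin k → (q : ℕ) → complexBetti (fiberOver f t) (2 * q)} {c : Fin k → ℂ} {a : ℂ}
    {z : complexBetti (fiberOver f t) (2 * p)}
    (hdat : ∀ i, p ∈ I i ∧ 𝒪 n (fiberOver f t) (I i) (κ i) ∧ ∀ q ∈ I i, IsOfHodgeType n (fiberOver f t) (2 * q) q q (κ i q))
    (ha : a ≠ 0) (hz : z ∈ algebraicClasses (fiberOver f t) p ∧ z ∈ divisorClassesSpan (fiberOver f t) n p)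
    (hsum : a • complexBetti.map (fiberι f t) (2 * p) W + z = ∑ i, c i • κ i p) :
    ∃ (𝒳' S' : SchemeOver ℂ) (f' : 𝒳' ⟶ S') (t' : ComplexPoints S') (e : fiberOver f' t' ≅ fiberOver f t)
      (W' : complexBetti 𝒳' (2 * p))
      (k : ℕ) (s : Fin k → ComplexPoints S') (I : Fin k → Finset ℕ)
      (κ : (i : Fin k) → (q : ℕ) → complexBetti (fiberOver f' (s i)) (2 * q))
      (V : Fin k → (q : ℕ) → complexBetti 𝒳' (2 * q)) (c : Fin k → ℂ) (a : ℂ) (Z : complexBetti 𝒳' (2 * p)),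
      IsSmoothProjectiveFamily f' n ∧ IsQuasiProjectiveOver 𝒳' ∧ IrreducibleSpace S'.left ∧ IsAffine S'.left ∧
      AlgebraicGeometry.Smooth S'.hom ∧ topologicalKrullDim S'.left = 1 ∧
      complexBetti.map e.hom (2 * p) (complexBetti.map (fiberι f t) (2 * p) W) =
        complexBetti.map (fiberι f' t') (2 * p) W' ∧
      (∀ i, p ∈ I i ∧ 𝒪 n (fiberOver f' (s i)) (I i) (κ i) ∧
        (∀ q ∈ I i, κ i q = complexBetti.map (fiberι f' (s i)) (2 * q) (V i q)) ∧
        (∀ q ∈ I i, ∀ u : ComplexPoints S',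
          IsOfHodgeType n (fiberOver f' u) (2 * q) q q (complexBetti.map (fiberι f' u) (2 * q) (V i q)))) ∧
      a ≠ 0 ∧
      (∀ u : ComplexPoints S',
        complexBetti.map (fiberι f' u) (2 * p) Z ∈ algebraicClasses (fiberOver f' u) p ∧
        complexBetti.map (fiberι f' u) (2 * p) Z ∈ divisorClassesSpan (fiberOver f' u) n p) ∧
      a • W' + Z = ∑ i, c i • V i p := by
  -- the fibre `X_t` and the base `𝔸¹`
  have hX : IsSmoothProjective n (fiberOver f t) := hf.isSmoothProjective t
  haveI : IrreducibleSpace (specOver ℂ (MvPolynomial (Fin 1) ℂ)).left := irreducibleSpace_affineLine_left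
  haveI : IsAffine (specOver ℂ (MvPolynomial (Fin 1) ℂ)).left := isAffine_affineLine_left
  obtain ⟨s₀⟩ := nonempty_complexPoints_affineLine
  -- the constant pencil and its binders
  have hf' : IsSmoothProjectiveFamily (snd (fiberOver f t) (specOver ℂ (MvPolynomial (Fin 1) ℂ))) n :=
    isSmoothProjectiveFamily_snd hX _
  have h𝒳' : IsQuasiProjectiveOver (fiberOver f t ⊗ specOver ℂ (MvPolynomial (Fin 1) ℂ)) :=
    isQuasiProjectiveOver_tensor_of_isProjectiveOver hX.isProjectiveOver isQuasiProjectiveOver_affineLine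
  have hres := fun (u : ComplexPoints (specOver ℂ (MvPolynomial (Fin 1) ℂ))) (k : ℕ) (x : complexBetti (fiberOver f t) k) ↦
    map_fiberι_map_fst_eq (X := fiberOver f t) u k x
  refine ⟨fiberOver f t ⊗ specOver ℂ (MvPolynomial (Fin 1) ℂ), specOver ℂ (MvPolynomial (Fin 1) ℂ), snd (fiberOver f t) _, s₀,
    (sliceFiberIso (fiberOver f t) s₀).symm,
    complexBetti.map (fst (fiberOver f t) _) (2 * p) (complexBetti.map (fiberι f t) (2 * p) W), k, fun _ ↦ s₀, I,
    fun i q ↦ complexBetti.map (sliceFiberIso (fiberOver f t) s₀).symm.hom (2 * q) (κ i q),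
    fun i q ↦ complexBetti.map (fst (fiberOver f t) _) (2 * q) (κ i q), c, a,
    complexBetti.map (fst (fiberOver f t) _) (2 * p) z,
    hf', h𝒳', irreducibleSpace_affineLine_left, isAffine_affineLine_left, smooth_affineLine_hom,
    topologicalKrullDim_affineLine_left, ?_,
    fun i ↦ ⟨(hdat i).1, h𝒪 n (sliceFiberIso (fiberOver f t) s₀).symm (I i) (κ i) (hdat i).2.1, fun q _ ↦ ?_, fun q hq u ↦ ?_⟩,
    ha, fun u ↦ ⟨?_, ?_⟩, ?_⟩
  · rw [hres s₀, Iso.symm_hom]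
  · rw [hres s₀, Iso.symm_hom]
  · rw [hres u]
    exact (isOfHodgeType_map_iff_of_iso (sliceFiberIso (fiberOver f t) u).symm).2 ((hdat i).2.2 q hq)
  · rw [hres u]
    exact (mem_algebraicClasses_map_iff_of_iso (sliceFiberIso (fiberOver f t) u).symm).2 hz.1
  · rw [hres u]
    exact map_mem_divisorClassesSpan (hf'.isSmoothProjective u) hX (sliceFiberIso (fiberOver f t) u).inv hz.2
  · have h := congrArg (complexBetti.map (fst (fiberOver f t) (specOver ℂ (MvPolynomial (Fin 1) ℂ))) (2 * p)) hsum
    rw [map_add, map_smul, map_sum] at h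
    simp_rw [map_smul] at h
    simpa only using h

/-- **Pointwise data on EVERY fibre give the local graded crux on that pencil** (door respecting isomorphisms): the per-pencil
statement of `AdmissibleRepresentativesLefAtDegLocal 𝒪 n p` holds for `(f, W)` as soon as every fibre `X_t` carries finitely many
`𝒪`-data spanning `a_t•W|_{X_t} + z_t`. (The isotrivial instance fibre by fibre; `k = 0` at the fibres where `W|_{X_t}` is algebraic-Lefschetz.)
[cite: Hartshorne1977, II.3 (p. 89)] [cite: vanGeemen1994HodgeAV, §2.4] -/
theorem local_conclusion_forall_of_pointwise
    (h𝒪 : ∀ (n : ℕ) ⦃Y Y' : SchemeOver ℂ⦄ (e : Y' ≅ Y) (I : Finset ℕ) (κ : (q : ℕ) → complexBetti Y (2 * q)),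
      𝒪 n Y I κ → 𝒪 n Y' I (fun q ↦ complexBetti.map e.hom (2 * q) (κ q)))
    (f : 𝒳 ⟶ S) (hf : IsSmoothProjectiveFamily f n) (W : complexBetti 𝒳 (2 * p))
    (hpt : ∀ t : ComplexPoints S, ∃ (k : ℕ) (I : Fin k → Finset ℕ) (κ : Fin k → (q : ℕ) → complexBetti (fiberOver f t) (2 * q))
      (c : Fin k → ℂ) (a : ℂ) (z : complexBetti (fiberOver f t) (2 * p)),
      (∀ i, p ∈ I i ∧ 𝒪 n (fiberOver f t) (I i) (κ i) ∧ ∀ q ∈ I i, IsOfHodgeType n (fiberOver f t) (2 * q) q q (κ i q)) ∧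
      a ≠ 0 ∧ (z ∈ algebraicClasses (fiberOver f t) p ∧ z ∈ divisorClassesSpan (fiberOver f t) n p) ∧
      a • complexBetti.map (fiberι f t) (2 * p) W + z = ∑ i, c i • κ i p)
    (t : ComplexPoints S) :
    ∃ (𝒳' S' : SchemeOver ℂ) (f' : 𝒳' ⟶ S') (t' : ComplexPoints S') (e : fiberOver f' t' ≅ fiberOver f t)
      (W' : complexBetti 𝒳' (2 * p))
      (k : ℕ) (s : Fin k → ComplexPoints S') (I : Fin k → Finset ℕ)
      (κ : (i : Fin k) → (q : ℕ) → complexBetti (fiberOver f' (s i)) (2 * q))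
      (V : Fin k → (q : ℕ) → complexBetti 𝒳' (2 * q)) (c : Fin k → ℂ) (a : ℂ) (Z : complexBetti 𝒳' (2 * p)),
      IsSmoothProjectiveFamily f' n ∧ IsQuasiProjectiveOver 𝒳' ∧ IrreducibleSpace S'.left ∧ IsAffine S'.left ∧
      AlgebraicGeometry.Smooth S'.hom ∧ topologicalKrullDim S'.left = 1 ∧
      complexBetti.map e.hom (2 * p) (complexBetti.map (fiberι f t) (2 * p) W) =
        complexBetti.map (fiberι f' t') (2 * p) W' ∧
      (∀ i, p ∈ I i ∧ 𝒪 n (fiberOver f' (s i)) (I i) (κ i) ∧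
        (∀ q ∈ I i, κ i q = complexBetti.map (fiberι f' (s i)) (2 * q) (V i q)) ∧
        (∀ q ∈ I i, ∀ u : ComplexPoints S',
          IsOfHodgeType n (fiberOver f' u) (2 * q) q q (complexBetti.map (fiberι f' u) (2 * q) (V i q)))) ∧
      a ≠ 0 ∧
      (∀ u : ComplexPoints S',
        complexBetti.map (fiberι f' u) (2 * p) Z ∈ algebraicClasses (fiberOver f' u) p ∧
        complexBetti.map (fiberι f' u) (2 * p) Z ∈ divisorClassesSpan (fiberOver f' u) n p) ∧
      a • W' + Z = ∑ i, c i • V i p := by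
  obtain ⟨k, I, κ, c, a, z, hdat, ha, hz, hsum⟩ := hpt t
  exact local_conclusion_of_pointwise h𝒪 f hf W t hdat ha hz hsum

end Summit.HodgeConjecture.HodgeConjecture.Ring2.SemiregularRepresentatives

end
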